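import Literature.Computability.AlgebraicComplexity.NoncommutativeCircuits
import HarnessLib

/-!
# Intersecting a noncommutative circuit with a finite automaton

Workshop instrument for the node `CommutativityDial` (decomp-valiant lens 6): the Arvind–Joglekar
automaton intersection, in the tree's fan-in-two model `ArithCircuit` with its free-algebra
semantics `ArithCircuit.ncEval`. For a transition table `δ : Q → σ → Q` on a finite state set `Q`
(all pairs of states are kept; a word `w` drives `a` to `w.foldl δ a`) the **`(a,b)`-part** of
`f ∈ R⟨σ⟩` is `dfaProj δ a b f := Σ_{w : δ̂(a,w) = b} coeff_w(f) · w`, an `R`-linear map built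
through the monoid algebra of the free monoid. Over every commutative semiring: (I1) `dfaProj_mul`,
the CONVOLUTION `(fg)^{a,b} = Σ_c f^{a,c} g^{c,b}`; (I3) `hasNcCircuitSizeLE_dfaProj`: **a fan-in-two
noncommutative circuit of size `s` for `f` yields one of size `≤ (2|Q|+1)·|Q|²·s` for each part
`f^{a,b}`** (the gates `⟨g,a,b⟩` of Arvind–Joglekar 2009 Thm 1(1); §2 is the budget-free toolkit
for appending gates to a noncommutative straight-line program, twin of `SmlHomogenise`). Partition,
parts of words and the application (Arvind–Srinivasan 2010 Thm 10, discharging the named fact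
`AS10_thm_10`) are in `NcCayleyDeterminant.lean`. HONEST FRAMING: theorem in print (Arvind–Joglekar
MFCS 2009 Thm 1; Arvind–Mukhopadhyay–Srinivasan 2008 Thm 2), new in the kernel; `VP ≠ VNP` untouched.
-/
noncomputable section

namespace Summit.ValiantsHypothesis.ValiantsHypothesis.Theorems.NcAutomatonIntersection

open Literature.Computability.AlgebraicComplexity
open Literature.Computability.AlgebraicComplexity.ArithCircuit

universe u v w

/-! ## §1 The `(a,b)`-parts of a noncommutative polynomial -/

section Projection

variable {R : Type u} [CommSemiring R] {σ : Type v} {Q : Type w} [DecidableEq Q] (δ : Q → σ → Q)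

/-- The part of ONE word along `a ⟶ b` (the word or `0`). [cite: ArvindJoglekar2009, Thm 1] -/
def wordDfa (a b : Q) (w : List σ) : FreeAlgebra R σ :=
  if w.foldl δ a = b then (w.map (FreeAlgebra.ι R)).prod else 0

/-- The `(a,b)`-projection on the monoid algebra. [cite: ArvindJoglekar2009, Thm 1] -/
def dfaProjMA (a b : Q) : MonoidAlgebra R (FreeMonoid σ) →ₗ[R] FreeAlgebra R σ :=
  Finsupp.linearCombination R (fun w : FreeMonoid σ => wordDfa (R := R) δ a b w.toList) ∘ₗ
    (MonoidAlgebra.coeffLinearEquiv R).toLinearMap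

/-- `dfaProjMA` on a single word. [cite: ArvindJoglekar2009, Thm 1] -/
@[simp] theorem dfaProjMA_single (a b : Q) (w : FreeMonoid σ) (r : R) :
    dfaProjMA (R := R) δ a b (MonoidAlgebra.single w r) = r • wordDfa δ a b w.toList := by
  simp [dfaProjMA, Finsupp.linearCombination_single]

/-- **The `(a,b)`-part** `f ↦ Σ_{w : δ̂(a,w) = b} coeff_w(f) · w`. [cite: ArvindJoglekar2009, Thm 1] -/
def dfaProj (a b : Q) : FreeAlgebra R σ →ₗ[R] FreeAlgebra R σ :=
  dfaProjMA δ a b ∘ₗ (FreeAlgebra.equivMonoidAlgebraFreeMonoid (R := R) (X := σ)).toLinearMap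

/-- Unfolding `dfaProj`. [cite: ArvindJoglekar2009, Thm 1] -/
theorem dfaProj_apply (a b : Q) (f : FreeAlgebra R σ) :
    dfaProj δ a b f = dfaProjMA δ a b (FreeAlgebra.equivMonoidAlgebraFreeMonoid f) := rfl

/-- A letter `x` is kept by the `(a,b)`-part iff `δ a x = b`. [cite: ArvindJoglekar2009, Thm 1] -/
theorem dfaProj_ι (a b : Q) (x : σ) :
    dfaProj δ a b (FreeAlgebra.ι R x) = if δ a x = b then FreeAlgebra.ι R x else 0 := by
  have hx : FreeAlgebra.equivMonoidAlgebraFreeMonoid (FreeAlgebra.ι R x) =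
      MonoidAlgebra.single (FreeMonoid.of x) (1 : R) := by
    simp [FreeAlgebra.equivMonoidAlgebraFreeMonoid, MonoidAlgebra.of_apply]
  rw [dfaProj_apply, hx, dfaProjMA_single, one_smul, FreeMonoid.toList_of]
  unfold wordDfa
  simp only [List.foldl_cons, List.foldl_nil, List.map_cons, List.map_nil, List.prod_cons,
    List.prod_nil, mul_one]

/-- A scalar is kept by the `(a,b)`-part iff `a = b`. [cite: ArvindJoglekar2009, Thm 1] -/
theorem dfaProj_algebraMap (a b : Q) (c : R) :
    dfaProj δ a b (algebraMap R (FreeAlgebra R σ) c) =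
      if a = b then algebraMap R (FreeAlgebra R σ) c else 0 := by
  rw [dfaProj_apply, AlgEquiv.commutes, MonoidAlgebra.coe_algebraMap, Function.comp_apply,
    show (algebraMap R R) c = c from rfl, dfaProjMA_single, FreeMonoid.toList_one]
  unfold wordDfa
  simp only [List.foldl_nil, List.map_nil, List.prod_nil]
  by_cases h : a = b
  · rw [if_pos h, if_pos h, Algebra.algebraMap_eq_smul_one]
  · rw [if_neg h, if_neg h, smul_zero]

variable [Fintype Q]

/-- Convolution on words `(w₁w₂)^{a,b} = Σ_c w₁^{a,c} w₂^{c,b}`. [cite: ArvindJoglekar2009, Thm 1] -/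
theorem wordDfa_append (a b : Q) (w₁ w₂ : List σ) :
    wordDfa (R := R) δ a b (w₁ ++ w₂) = ∑ c, wordDfa (R := R) δ a c w₁ * wordDfa δ c b w₂ := by
  rw [Finset.sum_eq_single_of_mem (w₁.foldl δ a) (Finset.mem_univ _)
    (fun c _ hc => by rw [wordDfa, if_neg (Ne.symm hc), zero_mul])]
  unfold wordDfa
  rw [if_pos rfl, List.foldl_append, List.map_append, List.prod_append]
  by_cases h : List.foldl δ (List.foldl δ a w₁) w₂ = b
  · rw [if_pos h, if_pos h]
  · rw [if_neg h, if_neg h, mul_zero]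

/-- Convolution for `dfaProjMA`. [cite: ArvindJoglekar2009, Thm 1] -/
theorem dfaProjMA_mul (a b : Q) (x y : MonoidAlgebra R (FreeMonoid σ)) :
    dfaProjMA (R := R) δ a b (x * y) = ∑ c, dfaProjMA δ a c x * dfaProjMA δ c b y := by
  induction x using MonoidAlgebra.induction_linear with
  | zero => simp
  | add x x' hx hx' => simp only [add_mul, map_add, hx, hx', Finset.sum_add_distrib]
  | single w₁ r₁ =>
    induction y using MonoidAlgebra.induction_linear with
    | zero => simp
    | add y y' hy hy' => simp only [mul_add, map_add, hy, hy', Finset.sum_add_distrib]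
    | single w₂ r₂ =>
      rw [MonoidAlgebra.single_mul_single, dfaProjMA_single, FreeMonoid.toList_mul, wordDfa_append,
        Finset.smul_sum]
      refine Finset.sum_congr rfl fun c _ => ?_
      rw [dfaProjMA_single, dfaProjMA_single, smul_mul_smul_comm]

/-- (I1) **Convolution** `(fg)^{a,b} = Σ_c f^{a,c} · g^{c,b}`. [cite: ArvindJoglekar2009, Thm 1] -/
theorem dfaProj_mul (a b : Q) (f g : FreeAlgebra R σ) :
    dfaProj δ a b (f * g) = ∑ c, dfaProj δ a c f * dfaProj δ c b g := by
  simp only [dfaProj_apply, map_mul, dfaProjMA_mul]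

end Projection

/-! ## §2 Appending gates (availability `∃ u, u.RefsBelow gs.length ∧ u.ncEval (ncGateValues gs) = p`) -/

section Avail

variable {R : Type u} [CommSemiring R] {σ : Type v}

/-- The value of a gate operand. [cite: Nisan1991Noncommutative, §2] -/
theorem ncEval_gate (vals : List (FreeAlgebra R σ)) (j : ℕ) :
    (Operand.gate j : Operand R σ).ncEval vals = vals.getD j 0 := rfl

/-- Appending gates keeps the earlier values (with the length bookkeeping). [cite: Nisan1991Noncommutative, §2] -/
theorem ncGateValues_append_getD (gs t : List (Gate R σ)) :
    (ncGateValues (gs ++ t)).length = gs.length + t.length ∧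
      ∀ i < gs.length, (ncGateValues (gs ++ t)).getD i 0 = (ncGateValues gs).getD i 0 := by
  induction t using List.reverseRecOn with
  | nil =>
    simp only [List.append_nil, List.length_nil, Nat.add_zero, implies_true, and_true]
    induction gs using List.reverseRecOn with
    | nil => rfl
    | append_singleton gs g ih => simp [ih]
  | append_singleton t g ih =>
    refine ⟨?_, fun i hi => ?_⟩
    · rw [← List.append_assoc, ncGateValues_append_singleton, List.length_append, ih.1]
      simp only [List.length_append, List.length_singleton, Nat.add_assoc]
    · rw [← List.append_assoc, ncGateValues_append_singleton, List.getD_eq_getElem?_getD,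
        List.getElem?_append_left (by rw [ih.1]; omega), ← List.getD_eq_getElem?_getD, ih.2 i hi]

/-- The value of the last gate. [cite: Nisan1991Noncommutative, §2] -/
theorem ncGateValues_getD_length (gs : List (Gate R σ)) (g : Gate R σ) :
    (ncGateValues (gs ++ [g])).getD gs.length 0 = g.ncEval (ncGateValues gs) := by
  have hlen : (ncGateValues gs).length = gs.length := by simpa using (ncGateValues_append_getD gs []).1
  rw [ncGateValues_append_singleton, List.getD_eq_getElem?_getD, ← hlen,
    List.getElem?_append_right le_rfl, Nat.sub_self]
  rfl

/-- Earlier operands keep their values under appending. [cite: Nisan1991Noncommutative, §2] -/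
theorem operand_ncEval_of_prefix {gs gs' : List (Gate R σ)} (h : gs <+: gs') {u : Operand R σ}
    (hu : u.RefsBelow gs.length) : u.ncEval (ncGateValues gs') = u.ncEval (ncGateValues gs) := by
  obtain ⟨t, rfl⟩ := h
  cases u with
  | var i => rfl
  | const c => rfl
  | gate j => exact (ncGateValues_append_getD gs t).2 j hu

/-- Availability persists when gates are appended. [cite: Nisan1991Noncommutative, §2] -/
theorem avail_mono {gs gs' : List (Gate R σ)} (h : gs <+: gs') {p : FreeAlgebra R σ}
    (hp : ∃ u : Operand R σ, u.RefsBelow gs.length ∧ u.ncEval (ncGateValues gs) = p) :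
    ∃ u : Operand R σ, u.RefsBelow gs'.length ∧ u.ncEval (ncGateValues gs') = p := by
  obtain ⟨u, hu, rfl⟩ := hp
  refine ⟨u, ?_, operand_ncEval_of_prefix h hu⟩
  cases u with
  | var i => trivial
  | const c => trivial
  | gate j => exact Nat.lt_of_lt_of_le hu h.length_le

/-- Transport of availability along an equality. [cite: Nisan1991Noncommutative, §2] -/
theorem avail_congr {gs : List (Gate R σ)} {p q : FreeAlgebra R σ} (hpq : p = q)
    (hp : ∃ u : Operand R σ, u.RefsBelow gs.length ∧ u.ncEval (ncGateValues gs) = p) :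
    ∃ u : Operand R σ, u.RefsBelow gs.length ∧ u.ncEval (ncGateValues gs) = q := hpq ▸ hp

/-- Constants are available for free. [cite: Nisan1991Noncommutative, §2] -/
theorem avail_const (gs : List (Gate R σ)) (c : R) :
    ∃ u : Operand R σ, u.RefsBelow gs.length ∧
      u.ncEval (ncGateValues gs) = algebraMap R (FreeAlgebra R σ) c :=
  ⟨.const c, trivial, rfl⟩

/-- `0` is available for free. [cite: Nisan1991Noncommutative, §2] -/
theorem avail_zero (gs : List (Gate R σ)) :
    ∃ u : Operand R σ, u.RefsBelow gs.length ∧ u.ncEval (ncGateValues gs) = 0 :=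
  ⟨.const 0, trivial, (map_zero (algebraMap R (FreeAlgebra R σ)) : _)⟩

omit [CommSemiring R] in
/-- Appending a gate of fan-in `≤ 2` keeps fan-in two. [cite: Nisan1991Noncommutative, §2] -/
theorem fanIn_append {gs : List (Gate R σ)} (hgs : ∀ g ∈ gs, g.fanIn ≤ 2) {g : Gate R σ}
    (hg : g.fanIn ≤ 2) : ∀ g' ∈ gs ++ [g], g'.fanIn ≤ 2 := by
  intro g' hg'
  rcases List.mem_append.mp hg' with h | h
  · exact hgs g' h
  · rw [List.mem_singleton.mp h]; exact hg

/-- One appended fan-in-two gate makes `a • p + b • q` available. [cite: Nisan1991Noncommutative, §2] -/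
theorem extend_lin {gs : List (Gate R σ)} (h2 : ∀ g ∈ gs, g.fanIn ≤ 2) (a b : R)
    {p q : FreeAlgebra R σ}
    (hp : ∃ u : Operand R σ, u.RefsBelow gs.length ∧ u.ncEval (ncGateValues gs) = p)
    (hq : ∃ u : Operand R σ, u.RefsBelow gs.length ∧ u.ncEval (ncGateValues gs) = q) :
    ∃ gs' : List (Gate R σ), gs <+: gs' ∧ (∀ g ∈ gs', g.fanIn ≤ 2) ∧ gs'.length ≤ gs.length + 1 ∧
      ∃ u : Operand R σ, u.RefsBelow gs'.length ∧ u.ncEval (ncGateValues gs') = a • p + b • q := by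
  obtain ⟨u, -, hu⟩ := hp
  obtain ⟨w, -, hw⟩ := hq
  refine ⟨gs ++ [Gate.sum [(a, u), (b, w)]], List.prefix_append _ _,
    fanIn_append h2 (by simp [Gate.fanIn, Gate.args]), by simp, Operand.gate gs.length,
    by simp [Operand.RefsBelow], ?_⟩
  rw [ncEval_gate, ncGateValues_getD_length]
  simp [Gate.ncEval, hu, hw]

/-- `≤ 2|T|` appended fan-in-two gates make `Σ_{t ∈ T} p t * q t` available. [cite: ArvindJoglekar2009, Thm 1] -/
theorem extend_prodSum {κ : Type*} (T : Finset κ) {gs : List (Gate R σ)}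
    (h2 : ∀ g ∈ gs, g.fanIn ≤ 2) (p q : κ → FreeAlgebra R σ)
    (hp : ∀ t ∈ T, ∃ u : Operand R σ, u.RefsBelow gs.length ∧ u.ncEval (ncGateValues gs) = p t)
    (hq : ∀ t ∈ T, ∃ u : Operand R σ, u.RefsBelow gs.length ∧ u.ncEval (ncGateValues gs) = q t) :
    ∃ gs' : List (Gate R σ), gs <+: gs' ∧ (∀ g ∈ gs', g.fanIn ≤ 2) ∧
      gs'.length ≤ gs.length + 2 * T.card ∧
      ∃ u : Operand R σ, u.RefsBelow gs'.length ∧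
        u.ncEval (ncGateValues gs') = ∑ t ∈ T, p t * q t := by
  classical
  induction T using Finset.induction_on with
  | empty => exact ⟨gs, List.prefix_rfl, h2, by simp, .const 0, trivial, by simp [Operand.ncEval]⟩
  | @insert t T ht ih =>
    obtain ⟨gs₁, hpre₁, h2₁, hlen₁, acc, hacc, hacc_val⟩ :=
      ih (fun s hs => hp s (Finset.mem_insert_of_mem hs))
        (fun s hs => hq s (Finset.mem_insert_of_mem hs))
    obtain ⟨u, -, hu_val⟩ := avail_mono hpre₁ (hp t (Finset.mem_insert_self t T))
    obtain ⟨w, -, hw_val⟩ := avail_mono hpre₁ (hq t (Finset.mem_insert_self t T))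
    have hpre₂ : gs₁ <+: gs₁ ++ [Gate.prod [u, w]] := List.prefix_append _ _
    refine ⟨(gs₁ ++ [Gate.prod [u, w]]) ++
        [Gate.sum [((1 : R), acc), ((1 : R), Operand.gate gs₁.length)]],
      hpre₁.trans (hpre₂.trans (List.prefix_append _ _)),
      fanIn_append (fanIn_append h2₁ (by simp [Gate.fanIn, Gate.args]))
        (by simp [Gate.fanIn, Gate.args]), ?_,
      Operand.gate (gs₁ ++ [Gate.prod [u, w]]).length, by simp [Operand.RefsBelow], ?_⟩
    · simp only [List.length_append, List.length_singleton, Finset.card_insert_of_notMem ht]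
      omega
    · rw [ncEval_gate, ncGateValues_getD_length]
      simp only [Gate.ncEval, List.map_cons, List.map_nil, List.sum_cons, List.sum_nil, add_zero,
        one_smul]
      rw [operand_ncEval_of_prefix hpre₂ hacc, hacc_val, ncEval_gate, ncGateValues_getD_length,
        Finset.sum_insert ht, add_comm]
      simp [Gate.ncEval, hu_val, hw_val]

/-- Targets each `≤ cost` gates away are jointly `≤ cost·|T|` gates away. [cite: ArvindJoglekar2009, Thm 1] -/
theorem iterate_targets {κ : Type*} (T : Finset κ) (goal : κ → FreeAlgebra R σ) (cost : ℕ)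
    {gs : List (Gate R σ)} (h2 : ∀ g ∈ gs, g.fanIn ≤ 2)
    (hstep : ∀ t ∈ T, ∀ gs' : List (Gate R σ), gs <+: gs' → (∀ g ∈ gs', g.fanIn ≤ 2) →
      ∃ gs'' : List (Gate R σ), gs' <+: gs'' ∧ (∀ g ∈ gs'', g.fanIn ≤ 2) ∧
        gs''.length ≤ gs'.length + cost ∧
        ∃ u : Operand R σ, u.RefsBelow gs''.length ∧ u.ncEval (ncGateValues gs'') = goal t) :
    ∃ gs' : List (Gate R σ), gs <+: gs' ∧ (∀ g ∈ gs', g.fanIn ≤ 2) ∧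
      gs'.length ≤ gs.length + cost * T.card ∧
      ∀ t ∈ T, ∃ u : Operand R σ, u.RefsBelow gs'.length ∧ u.ncEval (ncGateValues gs') = goal t := by
  classical
  induction T using Finset.induction_on with
  | empty => exact ⟨gs, List.prefix_rfl, h2, by simp, fun t ht => absurd ht (by simp)⟩
  | @insert t T ht ih =>
    obtain ⟨gs₁, hpre₁, h2₁, hlen₁, havail₁⟩ := ih fun s hs => hstep s (Finset.mem_insert_of_mem hs)
    obtain ⟨gs₂, hpre₂, h2₂, hlen₂, havail₂⟩ := hstep t (Finset.mem_insert_self t T) gs₁ hpre₁ h2₁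
    refine ⟨gs₂, hpre₁.trans hpre₂, h2₂, ?_, fun s hs => ?_⟩
    · rw [Finset.card_insert_of_notMem ht, Nat.mul_succ]
      omega
    · rcases Finset.mem_insert.mp hs with rfl | hs
      · exact havail₂
      · exact avail_mono hpre₂ (havail₁ s hs)

end Avail

/-! ## §3 The intersected circuit (the gates `⟨g, a, b⟩`) -/

section Intersect

variable {R : Type u} [CommSemiring R] {σ : Type v} {Q : Type w} [Fintype Q] [DecidableEq Q]
  (δ : Q → σ → Q)

omit [Fintype Q] in
/-- Parts of the value of an operand, from parts of gate values. [cite: ArvindJoglekar2009, Thm 1] -/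
theorem avail_ncOperand {gs : List (Gate R σ)} (vals : List (FreeAlgebra R σ))
    (hvals : ∀ p ∈ vals, ∀ ab : Q × Q, ∃ u : Operand R σ, u.RefsBelow gs.length ∧
      u.ncEval (ncGateValues gs) = dfaProj δ ab.1 ab.2 p)
    (o : Operand R σ) (a b : Q) :
    ∃ u : Operand R σ, u.RefsBelow gs.length ∧
      u.ncEval (ncGateValues gs) = dfaProj δ a b (o.ncEval vals) := by
  cases o with
  | var x =>
    rw [show (Operand.var x : Operand R σ).ncEval vals = FreeAlgebra.ι R x from rfl, dfaProj_ι]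
    by_cases h : δ a x = b
    · rw [if_pos h]; exact ⟨.var x, trivial, rfl⟩
    · rw [if_neg h]; exact avail_zero gs
  | const c =>
    rw [show (Operand.const c : Operand R σ).ncEval vals = algebraMap R _ c from rfl,
      dfaProj_algebraMap]
    by_cases h : a = b
    · rw [if_pos h]; exact avail_const gs c
    · rw [if_neg h]; exact avail_zero gs
  | gate i =>
    rw [ncEval_gate, List.getD_eq_getElem?_getD]
    by_cases hi : i < vals.length
    · rw [List.getElem?_eq_getElem hi, Option.getD_some]
      exact hvals _ (List.getElem_mem hi) (a, b)
    · rw [List.getElem?_eq_none_iff.mpr (Nat.le_of_not_lt hi), Option.getD_none, map_zero]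
      exact avail_zero gs

/-- **One gate** `⟨g,a,b⟩`: `≤ 2|Q|+1` appended gates per pair of states. [cite: ArvindJoglekar2009, Thm 1] -/
theorem extend_ncGate {gs : List (Gate R σ)} (h2 : ∀ g ∈ gs, g.fanIn ≤ 2)
    (vals : List (FreeAlgebra R σ))
    (hops : ∀ (o : Operand R σ) (a b : Q), ∃ u : Operand R σ, u.RefsBelow gs.length ∧
      u.ncEval (ncGateValues gs) = dfaProj δ a b (o.ncEval vals))
    (g : Gate R σ) (hg : g.fanIn ≤ 2) :
    ∃ gs' : List (Gate R σ), gs <+: gs' ∧ (∀ g ∈ gs', g.fanIn ≤ 2) ∧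
      gs'.length ≤ gs.length + (2 * Fintype.card Q + 1) * (Finset.univ : Finset (Q × Q)).card ∧
      ∀ ab ∈ (Finset.univ : Finset (Q × Q)), ∃ u : Operand R σ, u.RefsBelow gs'.length ∧
        u.ncEval (ncGateValues gs') = dfaProj δ ab.1 ab.2 (g.ncEval vals) := by
  classical
  refine iterate_targets (Finset.univ : Finset (Q × Q))
    (fun ab => dfaProj δ ab.1 ab.2 (g.ncEval vals)) (2 * Fintype.card Q + 1) h2 ?_
  rintro ⟨a, b⟩ - gs' hpre h2'
  have hops' : ∀ (o : Operand R σ) (a b : Q), ∃ u : Operand R σ, u.RefsBelow gs'.length ∧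
      u.ncEval (ncGateValues gs') = dfaProj δ a b (o.ncEval vals) :=
    fun o a b => avail_mono hpre (hops o a b)
  dsimp only
  cases g with
  | sum args =>
    match args, hg with
    | [], _ => exact ⟨gs', List.prefix_rfl, h2', by omega,
        avail_congr (by simp [Gate.ncEval, Operand.ncEval]) (hops' (.const 0) a b)⟩
    | [(c, o)], _ =>
      obtain ⟨gs'', hpre'', h2'', hlen'', hav⟩ := extend_lin h2' c (0 : R) (hops' o a b) (hops' o a b)
      refine ⟨gs'', hpre'', h2'', by omega, avail_congr ?_ hav⟩
      simp [Gate.ncEval, map_smul]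
    | [(c, o), (c', o')], _ =>
      obtain ⟨gs'', hpre'', h2'', hlen'', hav⟩ := extend_lin h2' c c' (hops' o a b) (hops' o' a b)
      refine ⟨gs'', hpre'', h2'', by omega, avail_congr ?_ hav⟩
      simp [Gate.ncEval, map_smul]
    | _ :: _ :: _ :: _, hg => simp [Gate.fanIn, Gate.args] at hg
  | prod args =>
    match args, hg with
    | [], _ => exact ⟨gs', List.prefix_rfl, h2', by omega,
        avail_congr (by simp [Gate.ncEval, Operand.ncEval]) (hops' (.const 1) a b)⟩
    | [o], _ =>
      refine ⟨gs', List.prefix_rfl, h2', by omega, avail_congr ?_ (hops' o a b)⟩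
      simp [Gate.ncEval]
    | [o, o'], _ =>
      obtain ⟨gs'', hpre'', h2'', hlen'', hav⟩ :=
        extend_prodSum (Finset.univ : Finset Q) h2'
          (fun c => dfaProj δ a c (o.ncEval vals)) (fun c => dfaProj δ c b (o'.ncEval vals))
          (fun c _ => hops' o a c) (fun c _ => hops' o' c b)
      refine ⟨gs'', hpre'', h2'', ?_, avail_congr ?_ hav⟩
      · rw [Finset.card_univ] at hlen''
        omega
      · rw [show Gate.ncEval vals (Gate.prod [o, o']) = o.ncEval vals * o'.ncEval vals by
          simp [Gate.ncEval], dfaProj_mul]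
    | _ :: _ :: _ :: _, hg => simp [Gate.fanIn, Gate.args] at hg

/-- **All gates**: every part of every gate value, `≤ (2|Q|+1)·|Q×Q|·#gates` gates. [cite: ArvindJoglekar2009, Thm 1] -/
theorem extend_ncGates (cs : List (Gate R σ)) (hcs : ∀ g ∈ cs, g.fanIn ≤ 2) :
    ∃ gs : List (Gate R σ), (∀ g ∈ gs, g.fanIn ≤ 2) ∧
      gs.length ≤ (2 * Fintype.card Q + 1) * (Finset.univ : Finset (Q × Q)).card * cs.length ∧
      ∀ p ∈ ncGateValues cs, ∀ ab : Q × Q, ∃ u : Operand R σ, u.RefsBelow gs.length ∧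
        u.ncEval (ncGateValues gs) = dfaProj δ ab.1 ab.2 p := by
  induction cs using List.reverseRecOn with
  | nil => exact ⟨[], by simp, by simp, fun p hp => by simp [ncGateValues] at hp⟩
  | append_singleton cs g ih =>
    obtain ⟨gs₁, h2₁, hlen₁, havail₁⟩ := ih fun g' hg' => hcs g' (List.mem_append_left _ hg')
    obtain ⟨gs₂, hpre₂, h2₂, hlen₂, havail₂⟩ :=
      extend_ncGate δ h2₁ (ncGateValues cs) (fun o a b => avail_ncOperand δ _ havail₁ o a b) g
        (hcs g (List.mem_append_right _ (List.mem_singleton_self g)))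
    refine ⟨gs₂, h2₂, ?_, fun p hp ab => ?_⟩
    · simp only [List.length_append, List.length_singleton]
      rw [Nat.mul_succ]
      omega
    · rw [ncGateValues_append_singleton, List.mem_append, List.mem_singleton] at hp
      rcases hp with hp | rfl
      · exact avail_mono hpre₂ (havail₁ p hp ab)
      · exact havail₂ ab (Finset.mem_univ _)

/-- (I3) **Intersecting a noncommutative circuit with a finite automaton** (Arvind–Joglekar 2009 Thm 1(1);
any commutative semiring): size `s` for `f` ⟹ size `≤ (2|Q|+1)·|Q|²·s` for each part `f^{a,b}`.
[cite: ArvindJoglekar2009, Thm 1] -/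
theorem hasNcCircuitSizeLE_dfaProj (P : ArithCircuit R σ) (hP : P.IsFanInTwo) (a b : Q) :
    HasNcCircuitSizeLE (dfaProj δ a b P.ncEval)
      ((2 * Fintype.card Q + 1) * Fintype.card Q ^ 2 * P.size) := by
  classical
  obtain ⟨gs, h2, hlen, havail⟩ := extend_ncGates δ P.gates hP
  obtain ⟨u, -, hval⟩ := avail_ncOperand δ (gs := gs) (ncGateValues P.gates) havail P.output a b
  refine ⟨⟨gs, u⟩, h2, ?_, ?_⟩
  · show u.ncEval (ncGateValues gs) = dfaProj δ a b (P.output.ncEval (ncGateValues P.gates))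
    exact hval
  · show gs.length ≤ (2 * Fintype.card Q + 1) * Fintype.card Q ^ 2 * P.gates.length
    rw [Finset.card_univ, Fintype.card_prod, ← sq] at hlen
    exact hlen

end Intersect

end Summit.ValiantsHypothesis.ValiantsHypothesis.Theorems.NcAutomatonIntersection

end
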